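import Summits.AtomisticToContinuum.Crystallization.Theorems.FrustratedLawDichotomyStrainedPatchHomHertz
import Summits.AtomisticToContinuum.Crystallization.Theorems.FrustratedLawDichotomyStrainedPatchHomCurvKit

/-!
# Kernel kit for the SIGN-VERTEX / LDLᵀ curvature test (`hertzTest`), the lossless successor of `…HomCurvKit.domTest`

decomp-a2c hand-1 g27 (crux `AperiodicFrustratedLawGap`, stmt-AtomisticToContinuum-27623; `(H) HomFloor (1/625)`, hcp half; lever (C)).
`…HomHertz.quadForm_ge_of_signVertices` reduces `κ‖x‖² ≤ xᵀ(M + P)x` for all arrays `M` in an entrywise interval enclosure and all perturbations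
`|P| ≤ W` to eight exact PSD tests.  This file is the integer kernel side in the cell's fixed-point currency (`FI`, scale `SC = 2^48`):

* §1 `ldlTest`, `symTest` on integer `3 × 3` arrays (★ `quadForm_nonneg_of_ldlTest`: the cast array has non-negative form);
* §2 `signs` (the eight sign vectors), `vertexArr C2 R2 κS z = C2 − (z zᵀ) ∘ R2 − [i=j]·2κS` at scale `2·SC` (centre `lo + hi`, radius `hi − lo + 2W`);
* §3 ★ `hertzTest E W κS : Bool` and ★★★ `quadForm_ge_of_hertzTest`: `M_ij ∈ E_ij`, `|P_ij|·SC ≤ W_ij`, test passed ⟹ `(κS/SC)·Σx_i² ≤ Σ(M+P)_ij x_i x_j`;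
* §4 ★★★ `curvatureSum_ge_of_hertzTest` — the label-sum floor from per-label memberships (the `hessEntryFI` accumulator of `…HomCurvKit`) plus a
  perturbation array: the interface of the centred leaf; with `W = 0`, `P = 0` it is the drop-in replacement of `curvatureSum_ge_of_domTest`.

Kernel definitions (Bool/ℤ-valued, docstring'd) + soundness; 0 sorry; standard axioms; no instances / notation / `#eval`.
`--supports stmt-AtomisticToContinuum-27623`.
-/

noncomputable section

namespace Summit.AtomisticToContinuum.Crystallization.Theorems.FrustratedLawDichotomyStrainedPatchHomHertzKit

open scoped BigOperators RealInnerProductSpace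
open Literature.Analysis.ValidatedNumerics.Numerics
open Summit.AtomisticToContinuum.Crystallization.Theorems.FrustratedLawDichotomyStrainedPatchHomHertz
  (quadForm3_nonneg_of_minors quadForm_ge_of_signVertices)
open Summit.AtomisticToContinuum.Crystallization.Theorems.FrustratedLawDichotomyStrainedPatchHomConvexCurvature (norm_sq_eq_sum rankOne_term_eq_sum)
open Summit.AtomisticToContinuum.Crystallization.Theorems.FrustratedLawDichotomyStrainedPatchHomCurvKit (hessEntryFI mem_hessEntryFI)

/-! ## §1. Integer LDLᵀ and symmetry tests -/

/-- ★ The three leading minors of an integer `3 × 3` array: `m₁ > 0`, `m₂ > 0`, `m₃ ≥ 0`. -/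
def ldlTest (V : Fin 3 → Fin 3 → ℤ) : Bool :=
  decide (0 < V 0 0 ∧ 0 < V 0 0 * V 1 1 - V 0 1 ^ 2 ∧
    0 ≤ V 0 0 * (V 1 1 * V 2 2 - V 1 2 ^ 2) - V 0 1 * (V 0 1 * V 2 2 - V 1 2 * V 0 2) + V 0 2 * (V 0 1 * V 1 2 - V 1 1 * V 0 2))

/-- Symmetry of an integer `3 × 3` array (three equalities). -/
def symTest (V : Fin 3 → Fin 3 → ℤ) : Bool := decide (V 1 0 = V 0 1 ∧ V 2 0 = V 0 2 ∧ V 2 1 = V 1 2)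

/-- `symTest` gives full symmetry. [formal bookkeeping] -/
theorem sym_of_symTest {V : Fin 3 → Fin 3 → ℤ} (h : symTest V = true) : ∀ i j, V i j = V j i := by
  have h' := of_decide_eq_true h
  obtain ⟨h10, h20, h21⟩ := h'
  intro i j
  fin_cases i <;> fin_cases j <;> simp_all

/-- ★ An integer array passing `symTest` and `ldlTest` has non-negative real quadratic form. [folklore: `…HomHertz.quadForm3_nonneg_of_minors`] -/
theorem quadForm_nonneg_of_ldlTest {V : Fin 3 → Fin 3 → ℤ} (hs : symTest V = true) (h : ldlTest V = true) (x : Fin 3 → ℝ) :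
    0 ≤ ∑ i, ∑ j, ((V i j : ℤ) : ℝ) * (x i * x j) := by
  obtain ⟨h1, h2, h3⟩ := of_decide_eq_true h
  have hsym := sym_of_symTest hs
  refine quadForm3_nonneg_of_minors (fun i j => ((V i j : ℤ) : ℝ)) (fun i j => by rw [hsym i j]) ?_ ?_ ?_ x
  · exact_mod_cast h1
  · exact_mod_cast h2
  · exact_mod_cast h3

/-! ## §2. Sign vectors and vertex arrays -/

/-- The eight sign vectors of `{±1}³`. -/
def signs : List (Fin 3 → ℤ) :=
  [![1, 1, 1], ![1, 1, -1], ![1, -1, 1], ![1, -1, -1], ![-1, 1, 1], ![-1, 1, -1], ![-1, -1, 1], ![-1, -1, -1]]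

/-- Every real sign vector is the cast of one of the eight. [formal bookkeeping] -/
theorem exists_sign_cast (z : Fin 3 → ℝ) (hz : ∀ i, z i = 1 ∨ z i = -1) : ∃ zI ∈ signs, ∀ i, z i = ((zI i : ℤ) : ℝ) := by
  rcases hz 0 with h0 | h0 <;> rcases hz 1 with h1 | h1 <;> rcases hz 2 with h2 | h2
  · exact ⟨![1, 1, 1], by simp [signs], fun i => by fin_cases i <;> simp [h0, h1, h2]⟩
  · exact ⟨![1, 1, -1], by simp [signs], fun i => by fin_cases i <;> simp [h0, h1, h2]⟩
  · exact ⟨![1, -1, 1], by simp [signs], fun i => by fin_cases i <;> simp [h0, h1, h2]⟩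
  · exact ⟨![1, -1, -1], by simp [signs], fun i => by fin_cases i <;> simp [h0, h1, h2]⟩
  · exact ⟨![-1, 1, 1], by simp [signs], fun i => by fin_cases i <;> simp [h0, h1, h2]⟩
  · exact ⟨![-1, 1, -1], by simp [signs], fun i => by fin_cases i <;> simp [h0, h1, h2]⟩
  · exact ⟨![-1, -1, 1], by simp [signs], fun i => by fin_cases i <;> simp [h0, h1, h2]⟩
  · exact ⟨![-1, -1, -1], by simp [signs], fun i => by fin_cases i <;> simp [h0, h1, h2]⟩

/-- The vertex array at scale `2·SC`: `C2 − (z zᵀ) ∘ R2 − [i=j]·2κS`. -/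
def vertexArr (C2 R2 : Fin 3 → Fin 3 → ℤ) (κS : ℤ) (z : Fin 3 → ℤ) (i j : Fin 3) : ℤ :=
  C2 i j - z i * z j * R2 i j - (if i = j then 2 * κS else 0)

/-! ## §3. The test and its soundness -/

/-- ★ **SIGN-VERTEX TEST** on interval data: `E` encloses the matrix part (scale `SC`), `W ≥ |P|·SC` entrywise, floor `κS/SC`.  Centre `lo + hi` and
radius `hi − lo + 2W` at scale `2·SC`; every vertex array must be symmetric as data and pass the integer LDLᵀ test. -/
def hertzTest (E : Fin 3 → Fin 3 → FI) (W : Fin 3 → Fin 3 → ℤ) (κS : ℤ) : Bool :=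
  signs.all fun z =>
    symTest (vertexArr (fun i j => (E i j).lo + (E i j).hi) (fun i j => (E i j).hi - (E i j).lo + 2 * W i j) κS z) &&
      ldlTest (vertexArr (fun i j => (E i j).lo + (E i j).hi) (fun i j => (E i j).hi - (E i j).lo + 2 * W i j) κS z)

/-- ★★★ **SOUNDNESS OF `hertzTest`.**  If `M_ij ∈ E_ij`, `|P_ij|·SC ≤ W_ij` and `hertzTest E W κS = true` then
`(κS/SC)·Σ_i x_i² ≤ Σ_ij (M_ij + P_ij) x_i x_j` for every `x`. [folklore chaining: `…HomHertz.quadForm_ge_of_signVertices`] -/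
theorem quadForm_ge_of_hertzTest {E : Fin 3 → Fin 3 → FI} {W : Fin 3 → Fin 3 → ℤ} {κS : ℤ} (h : hertzTest E W κS = true)
    {M P : Fin 3 → Fin 3 → ℝ} (hM : ∀ i j, FI.mem (M i j) (E i j)) (hP : ∀ i j, |P i j| * SC ≤ (W i j : ℝ)) (x : Fin 3 → ℝ) :
    (κS : ℝ) / SC * ∑ i, x i ^ 2 ≤ ∑ i, ∑ j, (M i j + P i j) * (x i * x j) := by
  have hS : (0 : ℝ) < SC := by norm_num [SC]
  unfold hertzTest at h
  rw [List.all_eq_true] at h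
  set C2 : Fin 3 → Fin 3 → ℤ := fun i j => (E i j).lo + (E i j).hi with hC2
  set R2 : Fin 3 → Fin 3 → ℤ := fun i j => (E i j).hi - (E i j).lo + 2 * W i j with hR2
  -- the SCALED problem (by `2·SC`): centre `C2`, radius `R2`, floor `2κS`, array `2·SC·(M + P)`
  have key := quadForm_ge_of_signVertices (fun i j => (C2 i j : ℝ)) (fun i j => (R2 i j : ℝ)) (κ := 2 * (κS : ℝ)) ?_
    (fun i j => 2 * SC * (M i j + P i j)) ?_ x
  · have hsum : ∑ i, ∑ j, 2 * SC * (M i j + P i j) * (x i * x j) = 2 * SC * ∑ i, ∑ j, (M i j + P i j) * (x i * x j) := by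
      rw [Finset.mul_sum]
      refine Finset.sum_congr rfl fun i _ => ?_
      rw [Finset.mul_sum]
      exact Finset.sum_congr rfl fun j _ => by ring
    rw [hsum] at key
    rw [div_mul_eq_mul_div, div_le_iff₀ hS]
    nlinarith [key, Finset.sum_nonneg (fun i (_ : i ∈ (Finset.univ : Finset (Fin 3))) => sq_nonneg (x i))]
  · -- vertex forms are non-negative
    intro z hz y
    obtain ⟨zI, hzI, hzc⟩ := exists_sign_cast z hz
    have hb := h zI hzI
    rw [Bool.and_eq_true] at hb
    have hq := quadForm_nonneg_of_ldlTest hb.1 hb.2 y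
    have hentry : ∀ i j, ((C2 i j : ℝ) - z i * z j * (R2 i j : ℝ) - if i = j then 2 * (κS : ℝ) else 0) =
        ((vertexArr C2 R2 κS zI i j : ℤ) : ℝ) := by
      intro i j
      by_cases hij : i = j
      · simp only [vertexArr, hzc i, hzc j, if_pos hij]; push_cast; ring
      · simp only [vertexArr, hzc i, hzc j, if_neg hij]; push_cast; ring
    have hsum : ∑ i, ∑ j, ((C2 i j : ℝ) - z i * z j * (R2 i j : ℝ) - if i = j then 2 * (κS : ℝ) else 0) * (y i * y j) =
        ∑ i, ∑ j, ((vertexArr C2 R2 κS zI i j : ℤ) : ℝ) * (y i * y j) :=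
      Finset.sum_congr rfl fun i _ => Finset.sum_congr rfl fun j _ => by rw [hentry i j]
    rw [hsum]
    exact hq
  · -- entrywise: `|2·SC·(M + P) − (lo + hi)| ≤ hi − lo + 2W`
    intro i j
    have hm := hM i j
    have hlo : ((E i j).lo : ℝ) ≤ M i j * SC := hm.1
    have hhi : M i j * SC ≤ ((E i j).hi : ℝ) := hm.2
    have habsP := abs_le.1 (show |P i j * SC| ≤ (W i j : ℝ) by rw [abs_mul, abs_of_pos hS]; exact hP i j)
    simp only [hC2, hR2]
    push_cast
    rw [abs_le]
    constructor
    · linarith [habsP.1]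
    · linarith [habsP.2]

/-! ## §4. ★★★ The curvature-sum floor from the kernel test (matrix part from per-label memberships, plus a perturbation array) -/

/-- ★★★ **CURVATURE-SUM FLOOR FROM `hertzTest`.**  Per-label memberships `α_b ∈ A b`, `β_b ∈ B b`, `(c_b)_a ∈ C b a` over a duplicate-free label
list `L`, a perturbation array `P` with `|P_ij|·SC ≤ W_ij`, and `hertzTest (hessEntryFI L A B C) W κS = true` give, for every `Δ`,
`(κS/SC)·‖Δ‖² ≤ Σ_{b ∈ L} (α_b⟪c_b, Δ⟫² + β_b‖Δ‖²) + Σ_ij P_ij Δ_i Δ_j`.  With `W = 0`, `P = 0` this is the lossless successor of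
`…HomCurvKit.curvatureSum_ge_of_domTest`. [folklore chaining] -/
theorem curvatureSum_ge_of_hertzTest {ι : Type*} [DecidableEq ι] (L : List ι) (hL : L.Nodup) {α β : ι → ℝ}
    {c : ι → EuclideanSpace ℝ (Fin 3)} {A B : ι → FI} {C : ι → Fin 3 → FI} (hA : ∀ b ∈ L, FI.mem (α b) (A b))
    (hB : ∀ b ∈ L, FI.mem (β b) (B b)) (hC : ∀ b ∈ L, ∀ a, FI.mem (c b a) (C b a)) {P : Fin 3 → Fin 3 → ℝ} {W : Fin 3 → Fin 3 → ℤ}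
    (hP : ∀ i j, |P i j| * SC ≤ (W i j : ℝ)) {κS : ℤ} (h : hertzTest (hessEntryFI L A B C) W κS = true) (Δ : EuclideanSpace ℝ (Fin 3)) :
    (κS : ℝ) / SC * ‖Δ‖ ^ 2 ≤ (∑ b ∈ L.toFinset, (α b * ⟪c b, Δ⟫ ^ 2 + β b * ‖Δ‖ ^ 2)) + ∑ i, ∑ j, P i j * (Δ i * Δ j) := by
  have hmem := fun i j => mem_hessEntryFI L hL hA hB hC i j
  have key := quadForm_ge_of_hertzTest h hmem hP (fun i => Δ i)
  have hexp : (∑ b ∈ L.toFinset, (α b * ⟪c b, Δ⟫ ^ 2 + β b * ‖Δ‖ ^ 2)) + ∑ i, ∑ j, P i j * (Δ i * Δ j) =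
      ∑ i, ∑ j, ((∑ b ∈ L.toFinset, (α b * (c b i * c b j) + (if i = j then β b else 0))) + P i j) * (Δ i * Δ j) := by
    have h1 : ∑ b ∈ L.toFinset, (α b * ⟪c b, Δ⟫ ^ 2 + β b * ‖Δ‖ ^ 2) =
        ∑ i, ∑ j, (∑ b ∈ L.toFinset, (α b * (c b i * c b j) + (if i = j then β b else 0))) * (Δ i * Δ j) := by
      calc ∑ b ∈ L.toFinset, (α b * ⟪c b, Δ⟫ ^ 2 + β b * ‖Δ‖ ^ 2)
          = ∑ b ∈ L.toFinset, ∑ i, ∑ j, (α b * (c b i * c b j) + (if i = j then β b else 0)) * (Δ i * Δ j) :=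
            Finset.sum_congr rfl fun b _ => rankOne_term_eq_sum (α b) (β b) (c b) Δ
        _ = ∑ i, ∑ b ∈ L.toFinset, ∑ j, (α b * (c b i * c b j) + (if i = j then β b else 0)) * (Δ i * Δ j) := Finset.sum_comm
        _ = ∑ i, ∑ j, ∑ b ∈ L.toFinset, (α b * (c b i * c b j) + (if i = j then β b else 0)) * (Δ i * Δ j) :=
            Finset.sum_congr rfl fun i _ => Finset.sum_comm
        _ = ∑ i, ∑ j, (∑ b ∈ L.toFinset, (α b * (c b i * c b j) + (if i = j then β b else 0))) * (Δ i * Δ j) :=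
            Finset.sum_congr rfl fun i _ => Finset.sum_congr rfl fun j _ => by rw [Finset.sum_mul]
    rw [h1, ← Finset.sum_add_distrib]
    refine Finset.sum_congr rfl fun i _ => ?_
    rw [← Finset.sum_add_distrib]
    exact Finset.sum_congr rfl fun j _ => by ring
  rw [hexp, norm_sq_eq_sum]
  exact key

/-- ★ **The `W = 0`, `P = 0` specialisation** (drop-in for `curvatureSum_ge_of_domTest`). [folklore chaining] -/
theorem curvatureSum_ge_of_hertzTest0 {ι : Type*} [DecidableEq ι] (L : List ι) (hL : L.Nodup) {α β : ι → ℝ}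
    {c : ι → EuclideanSpace ℝ (Fin 3)} {A B : ι → FI} {C : ι → Fin 3 → FI} (hA : ∀ b ∈ L, FI.mem (α b) (A b))
    (hB : ∀ b ∈ L, FI.mem (β b) (B b)) (hC : ∀ b ∈ L, ∀ a, FI.mem (c b a) (C b a)) {κS : ℤ}
    (h : hertzTest (hessEntryFI L A B C) (fun _ _ => 0) κS = true) (Δ : EuclideanSpace ℝ (Fin 3)) :
    (κS : ℝ) / SC * ‖Δ‖ ^ 2 ≤ ∑ b ∈ L.toFinset, (α b * ⟪c b, Δ⟫ ^ 2 + β b * ‖Δ‖ ^ 2) := by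
  have key := curvatureSum_ge_of_hertzTest L hL hA hB hC (P := fun _ _ => 0) (W := fun _ _ => 0) (fun i j => by simp) h Δ
  simpa using key

end Summit.AtomisticToContinuum.Crystallization.Theorems.FrustratedLawDichotomyStrainedPatchHomHertzKit

end
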